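import Mathlib
import HarnessLib
import HarnessLib.Audit
import Summits.Schanuel.Statement
import Literature.FieldTheory.TranscendenceDegree.AlgebraicDependenceBookkeeping
import HarnessLib.Audit.Status.Attr

/-!
Route: SingularModulusScaling

DORMANT since 2026-08-24T09:00:25Z (reconciler: no traction for 6.6 d (last activity item-evidence-added at 2026-08-17T16:54:20Z); parked, not closed — `ledger route dormant route-Schanuel-SingularModulusScaling --off` to reactivate) — unstaffed, not closed; items shared with open routes are served there. `ledger route dormant <id> --off` reactivates.

# Route SingularModulusScaling — π is a universal CM period — scale the singular modulus k_r → 0,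
keep e^α fixed; a global mixed E⊠G relations theorem decides the π–LW sector δ-uniformly

It suffices to show X = CMBoundedDegreeFreeness ∧ RelSchanuelOverPiLWField. Write F(t) =
₂F₁(½,½;1;t) = Σₙ (C(2n,n)/4ⁿ)² tⁿ and
G(t) = ₂F₁(−½,½;1;t) (two G-functions with rational coefficients; K(k) = (π/2)F(k²), E(k) =
(π/2)G(k²)), and for r ≥ 1 let t_r = k_r² ∈ (0,1) be
the SINGULAR MODULUS of degree r, the unique solution of F(1−t) = √r·F(t) (K′/K = √r). Legendre's
relation in Ramanujan–Borwein form reads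
1/π = α(r)·F(t_r)² + √r·F(t_r)(G(t_r) − F(t_r)) with α(r) and t_r ALGEBRAIC (Kronecker–Weber;
BorweinBorwein1987 Ch. 5): π is a quadratic
G-value at algebraic points t_r ≈ 16e^{−π√r} → 0 whose Weil height grows (h(t_r) ≍ h(j) ≥
(3/√5)log|Δ| − 9.79, arXiv:1805.07167 Prop. 4.3).
CMBoundedDegreeFreeness (NEW, rank 2): for ℚ-free algebraic a₁,…,a_d and every degree bound δ there
is r₀ such that for all r ≥ r₀ NO nonzero
polynomial of total degree ≤ δ with algebraic coefficients vanishes at (e^{a₁},…,e^{a_d}, F(t_r),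
G(t_r)). Because the SAME π sits at every t_r,
bounded-degree freeness for large r accumulates to FULL transcendence of π over the
Lindemann–Weierstrass field: CMBoundedDegreeFreeness ⇒
PiFreeOverLWField (support PiFreeOfCMFreeness, provable now), and with the shared complement
RelSchanuelOverPiLWField (Schanuel relative to
ℚ(πi, ℚ̄, e^ℚ̄); decls shared verbatim with routes ExceptionalSubspaces / GaussianStokesSector) the
shared Assembly gives Schanuel. No card is realised
(plan-novel seat, operator barrier-inversion).
Lean: `(∀ (d : ℕ) (a : Fin d → ℂ), (∀ i, IsAlgebraic ℚ (a i)) → LinearIndependent ℚ a → ∀ δ : ℕ, ∃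
r₀ : ℕ, ∀ r : ℕ, r₀ ≤ r → ∀ t : ℝ, 0 < t → t < 1 → (∑' n : ℕ, ((Nat.centralBinom n : ℝ) / 4 ^ n) ^ 2
* (1 - t) ^ n) = Real.sqrt r * ∑' n : ℕ, ((Nat.centralBinom n : ℝ) / 4 ^ n) ^ 2 * t ^ n → ∀ P :
MvPolynomial (Fin d ⊕ Fin 2) ℂ, P ≠ 0 → (∀ m, IsAlgebraic ℚ (P.coeff m)) → P.totalDegree ≤ δ →
MvPolynomial.eval (Sum.elim (Complex.exp ∘ a) ![((∑' n : ℕ, ((Nat.centralBinom n : ℝ) / 4 ^ n) ^ 2 *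
t ^ n : ℝ) : ℂ), ((∑' n : ℕ, -(((Nat.centralBinom n : ℝ) / 4 ^ n) ^ 2 / (2 * (n : ℝ) - 1)) * t ^ n :
ℝ) : ℂ)]) P ≠ 0) ∧ (∀ (n : ℕ) (x : Fin n → ℂ), LinearIndependent ℚ ((Submodule.span ℚ ({z : ℂ |
IsAlgebraic ℚ z} ∪ {(Real.pi : ℂ) * Complex.I})).mkQ ∘ x) → (n : Cardinal) ≤ Algebra.trdeg
↥(IntermediateField.adjoin ℚ ({z : ℂ | IsAlgebraic ℚ z} ∪ {(Real.pi : ℂ) * Complex.I} ∪ Complex.exp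
'' {z : ℂ | IsAlgebraic ℚ z})) ↥(IntermediateField.adjoin ↥(IntermediateField.adjoin ℚ ({z : ℂ |
IsAlgebraic ℚ z} ∪ {(Real.pi : ℂ) * Complex.I} ∪ Complex.exp '' {z : ℂ | IsAlgebraic ℚ z}))
(Set.range x ∪ Set.range (Complex.exp ∘ x))))`

## Assembly
Pure logic over the items (sorry-free `closes` in glue.lean / Sketch.lean, axioms propext /
Classical.choice / Quot.sound): PiFreeOfCMFreeness turns
CMBoundedDegreeFreeness (+ the two singular-value supports) into PiFreeOverLWField, and the shared
Assembly PiFreeOverLWField → RelSchanuelOverPiLWField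
→ Schanuel (GL_n(ℚ)-adapted basis of span x ∩ V₂, Lindemann–Weierstrass, tower law; item
stmt-Schanuel-9557) concludes:
`closes h1 _ h3 _ s1 s2 s3 hA := hA (s3 h1 s1 s2) h3`. ExpLogBoundedDegree and PiFreeOverLWField
ride as hypotheses (the former is the engine's
first deliverable, the latter the shared sector decl), not because the glue needs them.

Rationale: WHY THIS LINE. BARRIER INVERSION (operator C). Assuming the whole catalogue, any proof of the summit
must (§6.1.12 of BARRIERS) run an engine whose output is
NON-LINEAR at the mixed pair (1, πi) — one Lindemann–Weierstrass coordinate (argument 1 algebraic,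
value e) and one logarithmic coordinate (argument πi
transcendental, value −1) — with non-soft, archimedean input (B7–B9), and B4 says the E-function
engine only lives at ALGEBRAIC arguments. Invert B4:
never feed πi as an argument; realise π as a VALUE of fixed G-functions at algebraic points. At any
fixed representation (4·arctan 1, 6·arcsin ½) π is
out of range of the Bombieri–André G-method (the point is not small against its height), but π is
the UNIVERSAL period (Legendre's relation holds on
every elliptic curve), so CM theory supplies infinitely many exact G-representations at the singular
moduli t_r, with |t_r| ≈ 16e^{−π√r} and height
h(t_r) → ∞; e^α stays an E-value at z = 1. Imported: G-function arithmetic and Bombieri's "global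
relations are functional" (Bombieri1981, Andre1989
Ch. VII; at CM points Beukers1993, Papas2025 = arXiv:2510.11814), singular values and Ramanujan-type
identities (BorweinBorwein1987,
Chudnovsky1988Ramanujan, Zudilin2005), Shimura reciprocity for nearly holomorphic forms
(Shimura1975Arith) to make the inherited relation GLOBAL at all
archimedean places, and Siegel–Shidlovskii (in tree,
`Literature.Barriers.Schanuel.siegelShidlovskii_algIndep_holds`) for the E-side. What no prior
route does: GaussianStokesSector keeps π at ONE algebraic point as a Stokes constant (E/Э division),
DiophantineDichotomy APPROXIMATES the transcendental
point; here every evaluation is exact and algebraic, and the new free parameter is the discriminant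
r → ∞ of the CM point.

RANKED CRUXES. #2 CMBoundedDegreeFreeness (crux) — for every d, every ℚ-linearly independent family
of algebraic numbers a₁,…,a_d and every δ there is r₀ such that for every r ≥ r₀ and the singular
modulus t = t_r ∈ (0,1) (F(1−t) = √r·F(t)), no nonzero P of total degree ≤ δ with algebraic
coefficients has P(e^{a₁},…,e^{a_d}, F(t), G(t)) = 0. The OUTPUT SHAPE of a mixed E⊠G Bombieri
theorem along the CM family (d = 0 is true: F(t_r), G(t_r) algebraically independent for every r by
G. Chudnovsky's π ⊥ K(k_r)). [difficulty: open-problem] (why it might fail: Implied by period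
conjectures but by NO printed theorem; the only candidate engine (MixedGlobalRelations) needs the
Ramanujan–Borwein identities to be Galois-covariant over the ring class field and a two-variable
zero estimate — with one place only, the product formula kills it.) [Chudnovsky1984,
Chudnovsky1988Ramanujan, Zudilin2005, Andre1989, Bombieri1981, arXiv:2510.11814, BorweinBorwein1987]
#3 ExpLogBoundedDegree (crux) — the q-SCALING RUNG of the same engine at RATIONAL points (one
archimedean place, no covariance issue): for ℚ-free algebraic a₁,…,a_d and every δ there is q₀ with:
for all integers q ≥ q₀ no nonzero P of total degree ≤ δ with algebraic coefficients vanishes at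
(e^{a₁},…,e^{a_d}, log(1 − 1/q)) — E-values at z = 1 against the G-value −Li₁(1/q). d = 0 is
Hermite–Lindemann; d = 1, δ = 1 ("1, e, log(1−1/q) ℚ̄-linearly independent for q ≥ q₀") is already
unprinted (Baker ⊕ Hermite linear rung open, FischlerRivoal2024 §2.1). The cheapest theorem the
mixed engine must deliver before it can touch π. [difficulty: L] (why it might fail: A bivariate
auxiliary Σ P(z,t)e^{kz}L(t)^b gains n! only in z, and z-derivatives alone are capped by the
exponential-polynomial zero estimate, leaving the single-row G-gain that carries no transcendental
e^a; t-derivatives need a multiplicity estimate on 𝔾ₐ-exp × unipotent log-system.)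
[doi:10.1073/pnas.81.22.7261, Andre1989, Beukers2006, arXiv:2301.13518, Shidlovskii1989]
#5 RelSchanuelOverPiLWField (crux) — Schanuel RELATIVE to K₂ = ℚ(ℚ̄ ∪ {πi} ∪ e^ℚ̄): for x₁,…,x_n
ℚ-linearly independent modulo V₂ = ℚ̄ ⊕ ℚπi, trdeg_{K₂} K₂(x, eˣ) ≥ n — the exact complement of the
π–LW sector (decl shared verbatim with GaussianStokesSector / ExceptionalSubspaces,
stmt-Schanuel-9548); no engine of this route touches it. [difficulty: open-problem] (why it might
fail: It is Schanuel off the π–LW sector verbatim (contains AlgIndepLogarithms and e ⊥ e^e relative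
to K₂); false iff Schanuel fails for a tuple independent modulo ℚ̄ ⊕ ℚπi; honest remainder,
conceded.) [Waldschmidt2000, Kirby2010EAEF, Lang1966, BaysKirby2018ANT]
#6 PiFreeOverLWField (crux) — the π–LW SECTOR: for ℚ-linearly independent algebraic a₁,…,a_d, trdeg
ℚ(π, e^{a₁},…,e^{a_d}) ≥ d+1 (d = 0 Lindemann, d = 1 ∋ e ⊥ π); decl shared verbatim
(stmt-Schanuel-9545); reached here through CMBoundedDegreeFreeness + PiFreeOfCMFreeness. [deps:
CMBoundedDegreeFreeness] [difficulty: open-problem] (why it might fail: Contains e ⊥ π and π ⊥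
e^{√2}; nothing beyond Lindemann–Weierstrass is known for any d ≥ 1; false iff π is algebraic over
some ℚ(e^{a₁},…,e^{a_d}).) [Waldschmidt2000, BaysKirby2018ANT, FresanJossen2020]
#9 SingularModulusExists (support) — for every integer r ≥ 1 there is t ∈ (0,1) with F(1−t) =
√r·F(t) (the singular modulus k_r²; F is continuous increasing on [0,1) with F(t) → ∞ as t → 1⁻, so
F(1−t)/F(t) decreases from +∞ to 0). Real analysis, provable now. [difficulty: M]
[BorweinBorwein1987, Mathlib:Nat.centralBinom]
#9 SingularValuesAlgebraic (support) — for r ≥ 1 and t ∈ (0,1) with F(1−t) = √r·F(t): t is algebraic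
(Abel–Kronecker–Weber: singular moduli) and α(r) := (1/π − √r(F(t)G(t) − F(t)²))/F(t)² is algebraic
(Ramanujan–Borwein singular value function, from Legendre's relation EK′ + E′K − KK′ = π/2 with K′ =
√r K and the algebraicity of the CM values of the non-holomorphic E₂*; BorweinBorwein1987 Ch. 5,
Masser1975). A printed theorem; Literature-fact candidate. [difficulty: L] [BorweinBorwein1987,
Masser1975, Chudnovsky1988Ramanujan, Shimura1975Arith]
#9 PiFreeOfCMFreeness (support) — CMBoundedDegreeFreeness → SingularModulusExists →
SingularValuesAlgebraic → PiFreeOverLWField. Proof (provable now): if trdeg ℚ(π, e^a) ≤ d, some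
nonzero P₀ ∈ ℚ[X₁..X_d, Y] kills (e^a, π); put L_r(Y,Z) = α(r)Y² + √r(YZ − Y²), so 1/π = L_r(F(t_r),
G(t_r)); then Q := L_r^m·P₀(X, 1/L_r) (m = deg_Y P₀) is nonzero, has algebraic coefficients and
total degree ≤ 3·deg P₀, and vanishes at (e^a, F(t_r), G(t_r)) for EVERY r ≥ 1 — contradiction at r
≥ r₀(3·deg P₀). [difficulty: M] [BorweinBorwein1987, Mathlib:MvPolynomial.totalDegree]

TWO-LAYER PLAN. Once ExpLogBoundedDegree (or its d = 1, δ = 1 rung) closes: CMBoundedDegreeFreeness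
⇐ CovariantPiIdentity (the Ramanujan–Borwein identity at t_r and
its Galois conjugates at every archimedean place inside the unit disc: Shimura reciprocity for
E₂*E₄/E₆-type nearly holomorphic functions) →
MixedGlobalRelations (Bombieri for E ⊠ G, filed untyped at open) → CMBoundedDegreeFreeness (k = 2,
depth 1). ExpLogBoundedDegree ⇐ BivariateZeroEstimate
(multiplicity estimate for ℤ[z, t, e^{kz}, L(t)^b] at (1, 1/q)) → ExpLogLinearRung (d = 1, δ = 1) →
ExpLogBoundedDegree.

KILL CRITERIA. (i) A proof that the Ramanujan–Borwein identities 1/π = α(r)F² + √r F(G − F) are NOT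
Galois-covariant over the ring class field for a positive
proportion of conjugates inside the unit disc closes the engine (single place ⇒ product-formula
death, recorded in NOTES) — close `refuted:CMBoundedDegreeFreeness`
only if the statement itself falls, else pivot the engine crux. (ii) A refutation of
ExpLogBoundedDegree at any (d, δ) with d ≥ 1 (an actual relation
between e^a and log(1 − 1/q) for infinitely many q) would refute Schanuel itself — a sensation; a
proof that NO bivariate E⊠G construction can give even
its d = 1, δ = 1 rung (a barrier theorem of Gevrey-mismatch type valid in TWO variables) retires the
route `exhausted`. (iii) PiFreeOverLWField proved elsewhere
(GaussianStokesSector, ExceptionalSubspaces) moots cruxes 2, 6 and leaves RelSchanuelOverPiLWField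
shared. (iv) RelSchanuelOverPiLWField refuted ⇒ ¬Schanuel.

NOT DECOMPOSED YET. The engine MixedGlobalRelations (Bombieri's theorem for E-functions in z ⊠
G-functions in t at (ξ, τ) with a height condition on τ over the places where
|τ|_v < R_v) is filed UNTYPED after open (heights over number fields of growing degree and
archimedean places are not worth typing before the q-scaling
rung moves); the covariance lemma; the numerology memo (constants of the idealised degree-blind
count: smallness μN(1−ε)Σ_{v∈S}log(1/|t_r|_v) = μN(1−ε)D·h
versus cost (μ−1)ND·h + D·H_Siegel, giving the threshold h(t_r) ≥ c(δ) met because h(t_r) ≫ log r);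
the passage from fundamental to arbitrary r.

CHEAPEST FALSIFIER. (a) LOOKUP, hours: Galois covariance of (α(r), t_r) over the ring class field —
BorweinBorwein1987 Ch. 5 tables of α(r) for class number 2, 3 (r = 5, 6, 7, 13, …)
and Shimura1975Arith Main Thm for E₂*-values; if covariance fails the global method has ONE place
and the recorded product-formula computation kills it.
(b) PEN-AND-PAPER numerology of the d = 1, δ = 1 rung of ExpLogBoundedDegree: does a bivariate
Hermite–Padé system for (1, e^z) ⊗ (1, log(1−t)) at
(1, 1/q) give |A + B·e + C·log(1−1/q)| small with integer A, B, C of controlled size for q ≥ q₀? If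
even this linear rung is out of reach, close the route.
I could run neither to completion in this session (no held copy of BorweinBorwein1987 / Andre1989;
recorded as wants).

NUMBERS. t_r = k_r² = λ(i√r-type CM point) ≈ 16e^{−π√r}; [ℚ(t_r):ℚ] ≍ class number of discriminant
−4r ≍ r^{1/2±ε} (Siegel); height of singular moduli
(3/√5)log|Δ| − 9.79 ≤ h(j_Δ) ≤ 3log|Δ| (arXiv:1805.07167 Props. 4.1, 4.3 and §3), and h(j) ≤ 6h(λ) +
O(1) via j = 256(1−λ+λ²)³/(λ²(1−λ)²), so
h(t_r) ≫ log r. Printed G-method outputs at CM points are height BOUNDS polynomial in the RELATION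
degree (André: exponent 9, or 4 for strongly non-trivial
relations; arXiv:2510.11814 §5.3), and Beukers/André CM relations have degree ∝ [ℚ(s):ℚ] because
they are products over places (ibid. Props. 4.3–4.4) —
the inherited relation here has degree 3·deg P₀, INDEPENDENT of r, which is the whole point. Known
unconditional corner: d = 0 of both new cruxes
(Chudnovsky1984: π ⊥ K(k_r); Hermite–Lindemann). Items at open: 8 (4 cruxes, 3 supports, 1 assembly)
+ 1 untyped crux to file.

DEFINITION REQUESTS. None needed for the typed items (F, G are inlined `tsum`s over
`Nat.centralBinom`; Mathlib only). To file after open: (1) untyped crux MixedGlobalRelations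
(informal; needs `IsGFunction`, a Weil height on ℚ̄ and archimedean places — definition requests
`--notion IsGFunction --topic Literature/NumberTheory/Transcendental`
and `--notion weilHeight` only when the q-scaling rung has moved); (2) cite fact "singular values
k_r, α(r) algebraic" (BorweinBorwein1987 Thm 5.1.? / Ch. 5) as a
Literature fact backing SingularValuesAlgebraic; (3) lit wants: Andre1989 Ch. VII (exact form of the
Hasse principle), BorweinBorwein1987 Ch. 4–5.

Novelty: Searches (2026-08-16): `lit search --source zbmath` "algebraic independence values E-functions
G-functions" (11 rows: Andre1989, Galochkin 2025 survey,
Chirskii, Xu 1995, Eckmann 1985 — mixed E/G only LINEAR and at one point, or separate), "algebraic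
independence of e and values of G-functions" (8 rows:
Chudnovsky PNAS 1984 doi:10.1073/pnas.81.22.7261, Bombieri1981, Väänänen, Matveev — pure G), "linear
independence of 1, e and log 2" (0 relevant),
"irrationality e + log 2" (0); `lit galaxy search --star all` "G-functions and geometry" (18 rows;
found arXiv:2510.11814 = G-values at CM points for
HEIGHT bounds / effective Brauer–Siegel, read pp. 3–4, 11, 15–16), "complex multiplication according
to Ramanujan" (20 rows; Chudnovsky seminar LNM 1383,
Zudilin survey arXiv:0712.1332 read p. 2: "rapid convergence … may be used for proving the
quantitative irrationality of π√d", citing Zudilin2005 and the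
Chudnovskys' 1988 programme); in-hub: 23 open route files, ~110 idea cards grepped for
Ramanujan/singular moduli/class number/Clausen (0 levers; nearest cards
tensor-mixed-gevrey-division, eg-freeness-siegel-rings, e-pi-obstruction-tate-gevrey,
two-point-efunctions — all single-point E/Э or E/G), BARRIERS.lean §1–§6.
Nearest prior art found: Chudnovsky1988Ramanujan + Zudilin2005 (doi:10.1070/sm2005v196n07abeh000945)
— Ramanujan-type series at a FIXED CM point give
irrationality MEASURES of π√d by the Padé/G-method; Beukers1993 / Andre1989 / arXiv:2510.11814 —
G-values at CM points yi  [refs: 10.1073/pnas.81.22.7261, 10.1070/sm2005v196n07abeh000945, 2510.11814, 0712.1332, 2301.13518, doi:10.1073/pnas.81.22.7261, doi:10.1070/sm2005v196n07abeh000945, Andre1989, Bombieri1981, Zudilin2005, Beukers1993, FischlerRivoal2024]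

Barriers (technique_class: g-functions, cm-singular-moduli, bombieri-global, e-functions): - technique_class: g-functions, cm-singular-moduli, bombieri-global, e-functions
- Literature.Barriers.Schanuel.EFunctionValuesAtAlgebraicPoints: EVADED by its own clause — every
argument is algebraic (z = 1 for e^{a_i z}, t = t_r); πi is never an argument of an E-function; π
enters as a G-VALUE through Legendre's relation at singular moduli. The barrier's printed belief
("e+π, eπ not E-values") is untouched: we never claim they are.
- Literature.Barriers.Schanuel.NesterenkoModularScope: modular/CM input is used at INFINITELY MANY
CM points (the scope caveat "nothing excludes a modular argument at other points or with more
functions"); the one-nome output trdeg ≥ 3 is not invoked; e is never a nome (cards nome-one-over-e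
/ two-pi-rectangle-audit recorded why that fails).
- Literature.Barriers.Schanuel.AlgebraicIndependenceOfLogarithms: the route's engine sector ℚ̄ ⊕ ℚπi
contains ONE logarithm (πi); two algebraically independent logarithms are NOT produced —
AlgIndepLogarithms sits inside the conceded complement RelSchanuelOverPiLWField exactly as in
ExceptionalSubspaces / GaussianStokesSector. Honest: it does not evade B1 for the summit; the bet is
the sector.
- Literature.Barriers.Schanuel.PeriodConjectureOverQbarScope: no period conjecture is used; CM
periods K(k_r) ~ Γ-values appear only as carriers and are eliminated by δ-uniformity (the conclusion
PiFreeOverLWField mentions no Γ-value).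
- Literature.Barriers.Schanuel.LargeTranscendenceDegree: not the several-variables Ge

History (route lifecycle, newest last):
- 2026-08-24T09:00:25Z · DORMANT — reconciler: no traction for 6.6 d (last activity item-evidence-added at 2026-08-17T16:54:20Z); parked, not closed — `ledger route dormant route-Schanuel-Singula (operator:999:2170166)

sub-problem: Schanuel · status: dormant · opened planner-plan-novel-Schanuel-Schanuel-03fec9a6-c-v2-g13-0 2026-08-16T22:50:54Z · rev 3 · ledger route-Schanuel-SingularModulusScaling
GENERATED by the gate from the ledger (D-0016/17). Provers cite these decls: `theorem foo : Summit.Schanuel.Schanuel.Theses.SingularModulusScaling.<Decl> := …` in Summits/Schanuel/Schanuel/Theorems/<Name>.lean.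
-/

namespace Summit.Schanuel.Schanuel.Theses.SingularModulusScaling

open scoped BigOperators Topology Manifold Classical MeasureTheory ProbabilityTheory Matrix InnerProductSpace ComplexConjugate ContinuousMap
open Filter Set Function TopologicalSpace MeasureTheory

attribute [summit_statement] _root_.Schanuel

open Literature.Periods

/-- item stmt-Schanuel-17191 · crux · rank 2 · open · by planner
why it might fail: Implied by period conjectures but by NO printed theorem; the only candidate engine (MixedGlobalRelations) needs the Ramanujan–Borwein identities to be Galois-covariant over the ring class field and a two-variable zero estimate — with one place only, the product formula kills it.
sources: Chudnovsky1984, Chudnovsky1988Ramanujan, Zudilin2005, Andre1989, Bombieri1981, arXiv:2510.11814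
[crux] for every d, every ℚ-linearly independent family of algebraic numbers a₁,…,a_d and every δ
there is r₀ such that for every r ≥ r₀ and the singular modulus t = t_r ∈ (0,1) (F(1−t) = √r·F(t)),
no nonzero P of total degree ≤ δ with algebraic coefficients has P(e^{a₁},…,e^{a_d}, F(t), G(t)) =
0. The OUTPUT SHAPE of a mixed E⊠G Bombieri theorem along the CM family (d = 0 is true: F(t_r),
G(t_r) algebraically independent for every r by G. Chudnovsky's π ⊥ K(k_r)). [difficulty:
open-problem] -/
@[route_item "route-Schanuel-SingularModulusScaling", crux]
def CMBoundedDegreeFreeness : Prop :=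
  ∀ (d : ℕ) (a : Fin d → ℂ), (∀ i, IsAlgebraic ℚ (a i)) → LinearIndependent ℚ a → ∀ δ : ℕ, ∃ r₀ : ℕ, ∀ r : ℕ, r₀ ≤ r → ∀ t : ℝ, 0 < t → t < 1 → (∑' n : ℕ, ((Nat.centralBinom n : ℝ) / 4 ^ n) ^ 2 * (1 - t) ^ n) = Real.sqrt r * ∑' n : ℕ, ((Nat.centralBinom n : ℝ) / 4 ^ n) ^ 2 * t ^ n → ∀ P : MvPolynomial (Fin d ⊕ Fin 2) ℂ, P ≠ 0 → (∀ m, IsAlgebraic ℚ (P.coeff m)) → P.totalDegree ≤ δ → MvPolynomial.eval (Sum.elim (Complex.exp ∘ a) ![((∑' n : ℕ, ((Nat.centralBinom n : ℝ) / 4 ^ n) ^ 2 * t ^ n : ℝ) : ℂ), ((∑' n : ℕ, -(((Nat.centralBinom n : ℝ) / 4 ^ n) ^ 2 / (2 * (n : ℝ) - 1)) * t ^ n : ℝ) : ℂ)]) P ≠ 0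

/-- item stmt-Schanuel-17192 · crux · rank 3 · open · by planner
why it might fail: A bivariate auxiliary Σ P(z,t)e^{kz}L(t)^b gains n! only in z, and z-derivatives alone are capped by the exponential-polynomial zero estimate, leaving the single-row G-gain that carries no transcendental e^a; t-derivatives need a multiplicity estimate on 𝔾ₐ-exp × unipotent log-system.
sources: doi:10.1073/pnas.81.22.7261, Andre1989, Beukers2006, arXiv:2301.13518, Shidlovskii1989
[crux] the q-SCALING RUNG of the same engine at RATIONAL points (one archimedean place, no
covariance issue): for ℚ-free algebraic a₁,…,a_d and every δ there is q₀ with: for all integers q ≥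
q₀ no nonzero P of total degree ≤ δ with algebraic coefficients vanishes at (e^{a₁},…,e^{a_d}, log(1
− 1/q)) — E-values at z = 1 against the G-value −Li₁(1/q). d = 0 is Hermite–Lindemann; d = 1, δ = 1
("1, e, log(1−1/q) ℚ̄-linearly independent for q ≥ q₀") is already unprinted (Baker ⊕ Hermite linear
rung open, FischlerRivoal2024 §2.1). The cheapest theorem the mixed engine must deliver before it
can touch π. [difficulty: L] -/
@[route_item "route-Schanuel-SingularModulusScaling", crux]
def ExpLogBoundedDegree : Prop :=
  ∀ (d : ℕ) (a : Fin d → ℂ), (∀ i, IsAlgebraic ℚ (a i)) → LinearIndependent ℚ a → ∀ δ : ℕ, ∃ q₀ : ℕ, ∀ q : ℕ, q₀ ≤ q → ∀ P : MvPolynomial (Fin d ⊕ Fin 1) ℂ, P ≠ 0 → (∀ m, IsAlgebraic ℚ (P.coeff m)) → P.totalDegree ≤ δ → MvPolynomial.eval (Sum.elim (Complex.exp ∘ a) ![((Real.log (1 - 1 / (q : ℝ)) : ℝ) : ℂ)]) P ≠ 0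

/-- item stmt-Schanuel-9548 · crux · rank 5 · open · by planner
why it might fail: It is Schanuel off the π–LW sector verbatim (contains AlgIndepLogarithms and e ⊥ e^e relative to K₂); false iff Schanuel fails for a tuple independent modulo ℚ̄ ⊕ ℚπi; honest remainder, conceded.
sources: Waldschmidt2000, Kirby2010EAEF, Lang1966, BaysKirby2018ANT
[crux] the exact complement (Factor 2): for x₁,…,x_n ∈ ℂ ℚ-linearly independent modulo V₂ =
span_ℚ(ℚ̄ ∪ {πi}) = ℚ̄ ⊕ ℚπi, the transcendence degree of K₂(x, e^x) over K₂ = ℚ(ℚ̄ ∪ {πi} ∪ e^ℚ̄)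
is at least n — Schanuel relative to the field of the π–LW sector (same shape as
LogPatterns.OffLogSector / AdelicLogSector.OffPrimeLogSector, with which it shares all tuples off
the log lattice). Implied by Schanuel (Exactness: finite-coefficient descent K₂ → ℚ(w, e^w) for a
finite-dimensional W ∋ πi, then Schanuel at (w, x) and the tower law, using trdeg ℚ(w, e^w) ≤ dim W
on V₂). [difficulty: open-problem] -/
@[route_item "route-Schanuel-SingularModulusScaling", crux]
def RelSchanuelOverPiLWField : Prop :=
  ∀ (n : ℕ) (x : Fin n → ℂ), LinearIndependent ℚ ((Submodule.span ℚ ({z : ℂ | IsAlgebraic ℚ z} ∪ {(Real.pi : ℂ) * Complex.I})).mkQ ∘ x) → (n : Cardinal) ≤ Algebra.trdeg ↥(IntermediateField.adjoin ℚ ({z : ℂ | IsAlgebraic ℚ z} ∪ {(Real.pi : ℂ) * Complex.I} ∪ Complex.exp '' {z : ℂ | IsAlgebraic ℚ z})) ↥(IntermediateField.adjoin ↥(IntermediateField.adjoin ℚ ({z : ℂ | IsAlgebraic ℚ z} ∪ {(Real.pi : ℂ) * Complex.I} ∪ Complex.exp '' {z : ℂ | IsAlgebraic ℚ z})) (Set.range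 x ∪ Set.range (Complex.exp ∘ x)))

/-- item stmt-Schanuel-9545 · crux · rank 6 · open · by planner
why it might fail: Contains e ⊥ π and π ⊥ e^{√2}; nothing beyond Lindemann–Weierstrass is known for any d ≥ 1; false iff π is algebraic over some ℚ(e^{a₁},…,e^{a_d}).
sources: Waldschmidt2000, BaysKirby2018ANT, FresanJossen2020
[crux] the π–LW sector (Factor 1): for every d and every ℚ-linearly independent family of algebraic
numbers a₁,…,a_d, trdeg_ℚ ℚ(π, e^{a₁},…,e^{a_d}) ≥ d + 1, i.e. π is transcendental over the
Lindemann–Weierstrass field E = ℚ(e^α : α algebraic) (Schanuel at (πi, a₁,…,a_d); d = 0 is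
Lindemann, d = 1 is π ⊥ e^α for all algebraic α ≠ 0, PROVED off ℝ ∪ iℝ by ConjugationOffAxes).
Equivalently: π has no exceptional subspace. Its d = 1 layer is decomposed now (DOneGlue:
EndomorphismCriterion + GaloisOrbitRealised + RealAbelianResidue); d ≥ 2 has only the structural
handle ExceptionalSubspacesIntersect (the minimal exceptional subspace is unique and symmetric).
[difficulty: open-problem] -/
@[route_item "route-Schanuel-SingularModulusScaling", crux]
def PiFreeOverLWField : Prop :=
  ∀ (d : ℕ) (a : Fin d → ℂ), (∀ i, IsAlgebraic ℚ (a i)) → LinearIndependent ℚ a → ((d + 1 : ℕ) : Cardinal) ≤ Algebra.trdeg ℚ ↥(IntermediateField.adjoin ℚ (insert (Real.pi : ℂ) (Set.range (Complex.exp ∘ a))))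

-- item stmt-Schanuel-17208 · support · rank 4 · open · by planner — informal only, no Lean statement yet:
--   [crux] THE ENGINE (untyped at open): Bombieri's "global relations are functional" for E ⊠ G in two
--   variables. Let f = (f₁..f_m) be E-functions solving a linear differential system over K₀(z) and g =
--   (g₁..g_k) G-functions solving one over K₀(t) (K₀ a number field), with (f(z), g(t)) algebraically
--   independent over ℚ̄(z, t). Let ξ ∈ ℚ̄ˣ, τ ∈ ℚ̄, K = K₀(ξ, τ), and S = the set of places v of K with
--   |τ|_v < R_v(g) (archimedean v: the E-side is entire, so f(σ_v ξ) is defined at every v). If a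
--   polynomial P of degree ≤ δ with coefficients in K satisfies σ_v(P)(f(σ_v ξ), g(σ_v τ)) = 0 at EVERY
--   v ∈ S, an

/-- item stmt-Schanuel-17193 · support · rank 9 · open · by planner
sources: BorweinBorwein1987, Mathlib:Nat.centralBinom
[support] for every integer r ≥ 1 there is t ∈ (0,1) with F(1−t) = √r·F(t) (the singular modulus
k_r²; F is continuous increasing on [0,1) with F(t) → ∞ as t → 1⁻, so F(1−t)/F(t) decreases from +∞
to 0). Real analysis, provable now. [difficulty: M] -/
@[route_item "route-Schanuel-SingularModulusScaling"]
def SingularModulusExists : Prop :=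
  ∀ r : ℕ, 1 ≤ r → ∃ t : ℝ, 0 < t ∧ t < 1 ∧ (∑' n : ℕ, ((Nat.centralBinom n : ℝ) / 4 ^ n) ^ 2 * (1 - t) ^ n) = Real.sqrt r * ∑' n : ℕ, ((Nat.centralBinom n : ℝ) / 4 ^ n) ^ 2 * t ^ n

/-- item stmt-Schanuel-17194 · support · rank 9 · open · by planner
sources: BorweinBorwein1987, Masser1975, Chudnovsky1988Ramanujan, Shimura1975Arith
[support] for r ≥ 1 and t ∈ (0,1) with F(1−t) = √r·F(t): t is algebraic (Abel–Kronecker–Weber: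
singular moduli) and α(r) := (1/π − √r(F(t)G(t) − F(t)²))/F(t)² is algebraic (Ramanujan–Borwein
singular value function, from Legendre's relation EK′ + E′K − KK′ = π/2 with K′ = √r K and the
algebraicity of the CM values of the non-holomorphic E₂*; BorweinBorwein1987 Ch. 5, Masser1975). A
printed theorem; Literature-fact candidate. [difficulty: L] -/
@[route_item "route-Schanuel-SingularModulusScaling"]
def SingularValuesAlgebraic : Prop :=
  ∀ r : ℕ, 1 ≤ r → ∀ t : ℝ, 0 < t → t < 1 → (∑' n : ℕ, ((Nat.centralBinom n : ℝ) / 4 ^ n) ^ 2 * (1 - t) ^ n) = Real.sqrt r * ∑' n : ℕ, ((Nat.centralBinom n : ℝ) / 4 ^ n) ^ 2 * t ^ n → IsAlgebraic ℚ t ∧ IsAlgebraic ℚ ((1 / Real.pi - Real.sqrt r * ((∑' n : ℕ, ((Nat.centralBinom n : ℝ) / 4 ^ n) ^ 2 * t ^ n) * (∑' n : ℕ, -(((Nat.centralBinom n : ℝ) / 4 ^ n) ^ 2 / (2 * (n : ℝ) - 1)) * t ^ n) - (∑' n : ℕ, ((Nat.centralBinom n : ℝ) / 4 ^ n) ^ 2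 * t ^ n) ^ 2)) / (∑' n : ℕ, ((Nat.centralBinom n : ℝ) / 4 ^ n) ^ 2 * t ^ n) ^ 2)

/-- item stmt-Schanuel-17195 · support · rank 9 · open · by planner
sources: BorweinBorwein1987, Mathlib:MvPolynomial.totalDegree
[support] CMBoundedDegreeFreeness → SingularModulusExists → SingularValuesAlgebraic →
PiFreeOverLWField. Proof (provable now): if trdeg ℚ(π, e^a) ≤ d, some nonzero P₀ ∈ ℚ[X₁..X_d, Y]
kills (e^a, π); put L_r(Y,Z) = α(r)Y² + √r(YZ − Y²), so 1/π = L_r(F(t_r), G(t_r)); then Q :=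
L_r^m·P₀(X, 1/L_r) (m = deg_Y P₀) is nonzero, has algebraic coefficients and total degree ≤ 3·deg
P₀, and vanishes at (e^a, F(t_r), G(t_r)) for EVERY r ≥ 1 — contradiction at r ≥ r₀(3·deg P₀).
[difficulty: M] -/
@[route_item "route-Schanuel-SingularModulusScaling"]
def PiFreeOfCMFreeness : Prop :=
  CMBoundedDegreeFreeness → SingularModulusExists → SingularValuesAlgebraic → PiFreeOverLWField

/-- item stmt-Schanuel-17196 · assembly · rank 1 · open · by planner
sources: Kirby2010EAEF, Waldschmidt2000
[assembly] PiFreeOverLWField → RelSchanuelOverPiLWField → Schanuel (shared verbatim with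
GaussianStokesSector / ExceptionalSubspaces, stmt-Schanuel-9557). -/
@[route_item "route-Schanuel-SingularModulusScaling"]
def Assembly : Prop :=
  PiFreeOverLWField → RelSchanuelOverPiLWField → _root_.Schanuel

/-! D-0027 §2.1 — DECIDING THEOREM (planner-authored via `route open/edit --closes-file`; by planner-rrepair-Schanuel-SingularModulusScalin-1067b2d3-0 2026-08-17T00:15:35Z):
its hypotheses are this route's items and its conclusion the sub-problem Statement (glue_lint), and it elaborates with this file. -/

/-- **Deciding theorem** (D-0027 §2.1), crux-only, Mathlib + one fact-free folklore file (cone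
repair 2026-08-16): Kirby's `GL_n(ℚ)` sector split at `E = span_ℚ(ℚ̄ ∪ {πi})` over
`L = ℚ(ℚ̄, πi, e^ℚ̄)`; inside count from `PiFreeOverLWField`, outside from `RelSchanuelOverPiLWField`
after a matroid-basis base change, added along `ℚ ⊆ ℚ(y,eʸ) ⊆ ℚ(y,eʸ,z,eᶻ) ⊆ ℚ(x,eˣ)^alg`. -/
@[closes "route-Schanuel-SingularModulusScaling"] theorem closes (_ : CMBoundedDegreeFreeness) (_ : ExpLogBoundedDegree)
    (hR : RelSchanuelOverPiLWField) (hP : PiFreeOverLWField) : _root_.Schanuel := open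
  IntermediateField Complex Submodule Literature.FieldTheory.TranscendenceDegree in open
  Algebra (trdeg) in by
  intro n x hx
  have hFS : ∀ (A B : Type) [Field A] [Ring B] [Nontrivial B] [Algebra A B], FaithfulSMul A B :=
    fun A B _ _ _ _ => (faithfulSMul_iff_algebraMap_injective A B).2 (algebraMap A B).injective
  have hAC : ∀ {R : Type} [Field R] [Algebra R ℂ] {w : ℂ}, w ∈ algebraicClosure R ℂ ↔ IsAlgebraic R w :=
    mem_algebraicClosure_iff
  have hmo : ∀ {K : Type} [Field K] [Algebra K ℂ] {A B : IntermediateField K ℂ}, A ≤ B →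
      trdeg K A ≤ trdeg K B := fun h =>
    trdeg_le_of_injective (IntermediateField.inclusion h) (IntermediateField.inclusion_injective h)
  have hpow : ∀ (R : Type) [Field R] [Algebra R ℂ] (u : ℂ) (q : ℚ),
      exp u ∈ algebraicClosure R ℂ → exp (q * u) ∈ algebraicClosure R ℂ := by
    intro R _ _ u q hu
    rw [hAC]
    refine .of_pow q.den_pos ?_
    rw [← exp_nat_mul, ← mul_assoc, ← Rat.cast_natCast, ← Rat.cast_mul, Rat.den_mul_eq_num,
      Rat.cast_intCast, exp_int_mul]
    exact hAC.1 (zpow_mem hu _)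
  have hB5 : ∀ (K : Type) [Field K] [Algebra K ℂ] (M : IntermediateField K ℂ) (T : Set ℂ),
      T ⊆ algebraicClosure M ℂ → trdeg K (adjoin K T) ≤ trdeg K M := by
    intro K _ _ M T hT
    haveI := hFS K M; haveI := hFS M (algebraicClosure M ℂ)
    refine (hmo (show adjoin K T ≤ (algebraicClosure M ℂ).restrictScalars K from
      adjoin_le_iff.2 hT)).trans_eq ?_
    change trdeg K (algebraicClosure M ℂ) = _
    rw [← trdeg_add_eq K M, trdeg_eq_zero (R := M), add_zero]
  have hIns : ∀ (K : Type) [Field K] [Algebra K ℂ] (T : Set ℂ) (a : ℂ),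
      trdeg K (adjoin K (insert a T)) ≤ trdeg K (adjoin K T) + 1 := by
    intro K _ _ T a
    set M := adjoin K T
    haveI := hFS K M; haveI := hFS M M⟮a⟯
    have h1 : trdeg M M⟮a⟯ ≤ 1 := by
      refine (trdeg_le_card_of_forall_isAlgebraic M⟮a⟯.toSubalgebra {a}
        fun w hw => ?_).trans_eq (by rw [Finset.card_singleton, Nat.cast_one])
      rw [Finset.coe_singleton, ← isAlgebraic_adjoin_iff]
      exact isAlgebraic_algebraMap (⟨w, hw⟩ : M⟮a⟯)
    calc trdeg K (adjoin K (insert a T)) = trdeg K M⟮a⟯ := by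
          rw [← Set.union_singleton, ← (equivOfEq (adjoin_adjoin_left K T {a})).trdeg_eq]; rfl
      _ = trdeg K M + trdeg M M⟮a⟯ := (trdeg_add_eq K M).symm
      _ ≤ _ := add_le_add le_rfl h1
  have hTow : ∀ (K : Type) [Field K] [Algebra K ℂ] (S T : Set ℂ),
      trdeg K (adjoin K S) + trdeg (adjoin K S) (adjoin (adjoin K S) T) ≤
        trdeg K (adjoin K (S ∪ T)) := by
    intro K _ _ S T
    haveI := hFS K (adjoin K S); haveI := hFS (adjoin K S) (adjoin (adjoin K S) T)
    refine trdeg_add_le.trans_eq ?_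
    rw [← (equivOfEq (adjoin_adjoin_left K S T)).trdeg_eq]; rfl
  have hBC : ∀ (F₁ F₂ : IntermediateField ℚ ℂ), F₁ ≤ F₂ → ∀ S : Set ℂ, S.Finite →
      trdeg F₂ (adjoin F₂ S) ≤ trdeg F₁ (adjoin F₁ S) := by
    intro F₁ F₂ h12 S hS
    obtain ⟨t, ht⟩ := (AlgebraicIndependent.matroid F₂ ℂ).exists_isBasis S
    obtain ⟨hti, hts, hta⟩ := AlgebraicIndependent.matroid_isBasis_iff.1 ht
    have htf := hS.subset hts
    have hle : adjoin F₂ S ≤ (algebraicClosure (adjoin F₂ t) ℂ).restrictScalars F₂ :=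
      adjoin_le_iff.2 fun w hw => hAC.2 (isAlgebraic_adjoin_iff.2 (hta w hw))
    letI : Algebra F₁ F₂ := (IntermediateField.inclusion h12).toRingHom.toAlgebra
    haveI : IsScalarTower F₁ F₂ ℂ := .of_algebraMap_eq fun _ => rfl
    calc trdeg F₂ (adjoin F₂ S) ≤ htf.toFinset.card :=
          trdeg_le_card_of_forall_isAlgebraic (adjoin F₂ S).toSubalgebra htf.toFinset
            fun w hw => by
              rw [htf.coe_toFinset, ← isAlgebraic_adjoin_iff]
              exact hAC.1 (hle hw)
      _ = Cardinal.mk t := by rw [← ncard_eq_toFinset_card t htf, cast_ncard htf]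
      _ ≤ _ := (AlgebraicIndependent.of_comp (adjoin F₁ S).val
          (x := fun i : t => (⟨i, subset_adjoin F₁ S (hts i.2)⟩ : adjoin F₁ S))
          (hti.restrictScalars (IntermediateField.inclusion h12).injective)).cardinalMk_le_trdeg
  set E : Submodule ℚ ℂ := span ℚ ({z : ℂ | IsAlgebraic ℚ z} ∪ {(Real.pi : ℂ) * I})
    with hE
  set L := adjoin ℚ ({z : ℂ | IsAlgebraic ℚ z} ∪ {(Real.pi : ℂ) * I} ∪ exp '' {z : ℂ | IsAlgebraic ℚ z})
  have hdec : ∀ a ∈ E, ∃ b ∈ algebraicClosure ℚ ℂ, ∃ q : ℚ, a = b + q * (Real.pi * I) := by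
    intro a ha
    rw [hE, span_union, Submodule.mem_sup] at ha
    obtain ⟨b, hb, w, hw, rfl⟩ := ha
    obtain ⟨q, rfl⟩ := mem_span_singleton.1 hw
    exact ⟨b, (span_le (p := Subalgebra.toSubmodule (algebraicClosure ℚ ℂ).toSubalgebra)).2
      (fun u hu => hAC.2 hu) hb, q, by rw [Rat.smul_def]⟩
  have hEL : ∀ a ∈ E, a ∈ L ∧ exp a ∈ L := by
    intro a ha
    refine ⟨(span_le (p := Subalgebra.toSubmodule L.toSubalgebra)).2
      (fun s hs => subset_adjoin ℚ _ (.inl hs)) ha, ?_⟩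
    obtain ⟨b, hb, q, rfl⟩ := hdec a ha
    rw [exp_add]
    exact mul_mem (subset_adjoin ℚ _ (.inr ⟨b, hAC.1 hb, rfl⟩))
      (subset_adjoin ℚ _ (.inl (.inl
      (hAC.1 (hpow ℚ _ q (by rw [exp_pi_mul_I]; exact neg_mem (one_mem _)))))))
  have hIn : ∀ (k : ℕ) (y : Fin k → ℂ), (∀ i, y i ∈ E) → LinearIndependent ℚ y →
      (k : Cardinal) ≤ trdeg ℚ (adjoin ℚ (range y ∪ range (exp ∘ y))) := by
    intro k y hy hli
    choose b hb q hyq using fun i => hdec _ (hy i)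
    set F := adjoin ℚ (range y ∪ range (exp ∘ y))
    by_cases hq : ∀ i, q i = 0
    · have h1 := hP k y (fun i => hAC.1 (by
        rw [hyq i, hq i, Rat.cast_zero, zero_mul, add_zero]; exact hb i)) hli
      rw [Nat.cast_succ] at h1
      exact Cardinal.add_one_le_add_one_iff.1 (h1.trans ((hIns ℚ _ _).trans (add_le_add
        (hmo (adjoin.mono ℚ _ _ subset_union_right)) le_rfl)))
    obtain ⟨j, hj⟩ := not_forall.1 hq
    obtain ⟨k, rfl⟩ : ∃ k', k = k' + 1 := ⟨k - 1, by have := j.pos; omega⟩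
    have aF : ∀ {w : ℂ}, w ∈ F → IsAlgebraic F w := fun hw => isAlgebraic_algebraMap (⟨_, hw⟩ : F)
    have yF : ∀ i, y i ∈ F := fun i => subset_adjoin ℚ _ (.inl ⟨i, rfl⟩)
    have eF : ∀ i, exp (y i) ∈ algebraicClosure F ℂ := fun i =>
      hAC.2 (aF (subset_adjoin ℚ _ (.inr ⟨i, rfl⟩)))
    set a : Fin k → ℂ := fun s => q j • y (j.succAbove s) - q (j.succAbove s) • y j with ha
    have hal : ∀ s, IsAlgebraic ℚ (a s) := fun s => hAC.1 (by
      have : a s = (q j : ℂ) * b (j.succAbove s) - (q (j.succAbove s) : ℂ) * b j := by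
        simp only [ha, Rat.smul_def]
        rw [hyq (j.succAbove s), hyq j, mul_add, mul_add, mul_left_comm ((q j : ℚ) : ℂ),
          add_sub_add_right_eq_sub]
      rw [this]
      exact sub_mem (mul_mem (SubfieldClass.ratCast_mem _ _) (hb _))
        (mul_mem (SubfieldClass.ratCast_mem _ _) (hb _)))
    have hli' : LinearIndependent ℚ a := by
      rw [Fintype.linearIndependent_iff]
      intro g hg s
      have h0 := Fintype.linearIndependent_iff.mp hli
        (Fin.insertNth j (-∑ s, g s * q (j.succAbove s)) fun s => g s * q j) (by
          rw [Fin.sum_univ_succAbove _ j, Fin.insertNth_apply_same, ← hg]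
          simp only [Fin.insertNth_apply_succAbove, ha, smul_sub, mul_smul, neg_smul,
            Finset.sum_smul, Finset.sum_sub_distrib]
          abel) (j.succAbove s)
      rw [Fin.insertNth_apply_succAbove] at h0
      exact (mul_eq_zero.mp h0).resolve_right hj
    have hpi : IsAlgebraic F (Real.pi : ℂ) := by
      have hqj : ((q j : ℚ) : ℂ) ≠ 0 := by exact_mod_cast hj
      have h1 : (Real.pi : ℂ) * I = (y j - b j) * (((q j)⁻¹ : ℚ) : ℂ) := by
        rw [Rat.cast_inv, hyq j, add_sub_cancel_left, mul_comm ((q j : ℚ) : ℂ),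
          mul_inv_cancel_right₀ hqj]
      have h2 : (Real.pi : ℂ) = -(Real.pi * I * I) := by rw [mul_assoc, I_mul_I, mul_neg_one, neg_neg]
      rw [h2, h1]
      exact ((((aF (yF j)).sub ((hAC.1 (hb j)).tower_top (L := F))).mul
        (aF (SubfieldClass.ratCast_mem F _))).mul
        (.of_pow two_pos (by rw [I_sq]; exact isAlgebraic_one.neg))).neg
    refine (hP k a hal hli').trans (hB5 ℚ F _ ?_)
    rintro w (rfl | ⟨s, rfl⟩)
    · exact hAC.2 hpi
    · simp only [Function.comp_apply, ha, Rat.smul_def, exp_sub]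
      exact div_mem (hpow F _ _ (eF _)) (hpow F _ _ (eF _))
  set V : Submodule ℚ ℂ := span ℚ (range x) with hV
  haveI : FiniteDimensional ℚ V := FiniteDimensional.span_of_finite ℚ (finite_range x)
  obtain ⟨U', hU'⟩ := (V ⊓ E).exists_isCompl
  set W : Submodule ℚ ℂ := V ⊓ E
  set U : Submodule ℚ ℂ := V ⊓ U' with hU
  haveI : FiniteDimensional ℚ W := finiteDimensional_of_le inf_le_left
  haveI : FiniteDimensional ℚ U := finiteDimensional_of_le inf_le_left
  have hsup : W ⊔ U = V := by
    rw [hU, inf_comm, ← sup_inf_assoc_of_le U' (inf_le_left : W ≤ V), hU'.sup_eq_top, top_inf_eq]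
  have hdj : Disjoint W U := hU'.disjoint.mono_right inf_le_right
  set k := Module.finrank ℚ W
  set m := Module.finrank ℚ U
  have hn : k + m = n := by
    have h1 := finrank_sup_add_finrank_inf_eq W U
    rw [hdj.eq_bot, finrank_bot, add_zero, hsup, hV, finrank_span_eq_card hx, Fintype.card_fin] at h1
    exact h1.symm
  let bW := Module.finBasis ℚ W
  let bU := Module.finBasis ℚ U
  let y : Fin k → ℂ := fun i => bW i
  let z : Fin m → ℂ := fun j => bU j
  have hyli : LinearIndependent ℚ y := bW.linearIndependent.map' W.subtype W.ker_subtype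
  have hzli : LinearIndependent ℚ z := bU.linearIndependent.map' U.subtype U.ker_subtype
  have hyE : ∀ i, y i ∈ E := fun i => (bW i).2.2
  have hzE : LinearIndependent ℚ (E.mkQ ∘ z) := by
    refine hzli.map ?_
    rw [ker_mkQ, disjoint_def]
    intro u hu huE
    have huU : u ∈ U := span_le.2 (range_subset_iff.2 fun j => (bU j).2) hu
    exact disjoint_def.1 hdj u ⟨huU.1, huE⟩ huU
  set Sy := range y ∪ range (exp ∘ y)
  set Sz := range z ∪ range (exp ∘ z)
  set Ky := adjoin ℚ Sy
  set Kx := adjoin ℚ (range x ∪ range (exp ∘ x))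
  have hKyL : Ky ≤ L := adjoin_le_iff.2 (by
    rintro _ (⟨i, rfl⟩ | ⟨i, rfl⟩); exacts [(hEL _ (hyE i)).1, (hEL _ (hyE i)).2])
  have hVK : ∀ a ∈ V, a ∈ Kx ∧ exp a ∈ algebraicClosure Kx ℂ := by
    intro a ha
    obtain ⟨c, rfl⟩ := (mem_span_range_iff_exists_fun ℚ).1 ha
    refine ⟨sum_mem fun i _ => Kx.toSubalgebra.smul_mem (subset_adjoin ℚ _ (.inl ⟨i, rfl⟩)) _, ?_⟩
    simp_rw [Rat.smul_def]
    rw [exp_sum]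
    exact prod_mem fun i _ =>
      hpow Kx _ _ (hAC.2 (isAlgebraic_algebraMap (⟨_, subset_adjoin ℚ _ (.inr ⟨i, rfl⟩)⟩ : Kx)))
  refine (show (n : Cardinal) = k + m by rw [← hn, Nat.cast_add]).trans_le ((add_le_add
    (hIn k y hyE hyli) ((hR m z hzE).trans
    (hBC Ky L hKyL Sz ((finite_range z).union (finite_range _))))).trans ((hTow ℚ Sy Sz).trans (hB5 ℚ Kx _ ?_)))
  rintro w ((⟨i, rfl⟩ | ⟨i, rfl⟩) | (⟨j, rfl⟩ | ⟨j, rfl⟩))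
  · exact hAC.2 (isAlgebraic_algebraMap (⟨_, (hVK _ (bW i).2.1).1⟩ : Kx))
  · exact (hVK _ (bW i).2.1).2
  · exact hAC.2 (isAlgebraic_algebraMap (⟨_, (hVK _ (bU j).2.1).1⟩ : Kx))
  · exact (hVK _ (bU j).2.1).2

end Summit.Schanuel.Schanuel.Theses.SingularModulusScaling
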